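import Literature.MathematicalPhysics.QuantumFieldTheory.Balaban1983to89.Beta.ComposedRoad

/-!
# `BalabanUV.Beta.D1BFx.ShellWindowInterface` — road «BF-x» for binder row D1, sub-leaf C3-SHELL:
# THE WALL'S WINDOW INTERFACE RE-TYPED IN SHELL-ℓ¹ CURRENCY
# (the in-window comparison and the exterior tail are only ever SUMMED over the sup-norm shells `‖w‖∞ = r+1`; a leg whose
# pointwise (W2′) row is off by `log n` on a thin block-edge layer but whose SHELL SUMS are fine still feeds the wall)

HONEST DEPENDENCY (page 1, mandatory): continuum YM on T⁴ ⇐ BetaPertH ∧ nine spine estimates (0/9 proved); BetaPertH ⇐ (D1) ∧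
(D4) ∧ CAP+tail; G-an2-4 gates asym, D1 and NE2/3/4.  HONEST FRAMING (cell contract, verbatim): «discharging `BetaPertH` makes
Bałaban's UV stability UNCONDITIONAL — a real constructive-QFT result; it is NOT the continuum limit and NOT the Clay problem.»
THIS MODULE DISCHARGES NOTHING of the wall: it is [folklore] bookkeeping about ARBITRARY functions `ℤ⁴ → ℝ` and arbitrary
`BubbleTransfer.Leg` tables, composed BY NAME from the tree (`BubbleTransfer.windowDecomposition_of_bubble`,
`ComposedRoad.oneLoopDrift_of_composedWindow_identity` / `legAtZero` / `powFamily` / `abs_convexComb_sub_le`,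
`DyadicShell.sum_Ico_shellSum`, `TransferUV.card_annulus_succ_four_le`).  No `def`, no `Prop` mirror, no cited fact, 0 sorry.
Bookkeeping for ONE road (BF-x) to ONE conjunct (D1); 0 wall binders instantiated; NOT D1, NOT `BetaPertH`, NOT continuum, NOT Clay.

ABSOLUTE RULE (cell charter, verbatim): «No internally-minted statement may enter as a cited fact. Every hypothesis is either
kernel-proved in this package or a verbatim quotation of a PUBLISHED theorem with page reference. The manuscript(s) under audit are NOT
citable for their own disputed steps — they are the thing under adjudication; programme-internal (2001/route/tribunal) claims are never
citable.»  Accordingly nothing below is a statement about Bałaban's kernels; every hypothesis is a free binder on abstract families.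

WHY (skeleton `HOME/beta/skeletons/D1-b2b-balaban-beta-d1-p2.md` v1.4 nodes C/L/A; `LEAVES-BFx.md` sub-row C3-SHELL; journal CLAIM
l.11259; gen-3 RESULT l.10890 of this unit, EVIDENCE-GRADE).  The road END `D1BFx/RoadEnd.d1Drift_of_strongRoad` (C3) feeds an3's
`SquareTable.oneLoopDrift_of_scalarBounds_avg`, whose leg rows are POINTWISE: on the window `|F′ − f| ≤ R/(‖w‖∞^{a−2}·n²)` ((W2′),
`WindowInterface.inWindow_of_legPerturbation`), beyond it `|F′| ≤ R′‖w‖∞^{−a}e^{−(δ/n)‖w‖∞}`.  READ OFF THE TREE, the wall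
(`BubbleTransfer.windowDecomposition_of_bubble`, slot `hA₁`) keeps of all this exactly ONE number per blocking factor:
`|β⁰ − Σ_{0<‖w‖∞≤M(n)} w_μw_ν·lattBubble(table)| ≤ A₁` — only the WINDOW SUM of `K − K⁰` (`LargeLWindow.Split.rem_of_split`) and the
window sums of the tail (`WindowInterface.tail_sum_le_geom`) are ever used.  Gen 3 of this unit found, with two kit engines
(j094529/j094530) and a located heuristic, that for the block column of the B4-Sect.5 kernel the MIXED second difference at a block
EDGE grows like `η²(c₀ + c₁ log n)` — so the pointwise (W2′) row of a degree-4 leg (a mixed second difference of the corrected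
propagator) is, on that evidence, off by `log n` at `‖w‖∞ ≈ n`, whereas its SHELL SUM `Σ_{‖w‖∞ = r+1}|D_{μν}E_n|` is of size
`80(r+1)³(1 + log(n/(r+1)))/n⁴ ≤ 80/n` (the edge layer has relative measure `(ρ/n)²` in a shell; `x³(1 + log(1/x)) ≤ 1`).  This module
therefore re-types the interface so that ONLY SHELL SUMS are demanded of the legs that are not pointwise-good:
* §1 (A₁-FORM ALONG THE POWERS) `oneLoopDrift_of_windowSumPow_identity`: `|composedCoeff μC m − Σ_window K⁰_{Lc^m}| ≤ A₁` for
  `m ≥ 1` + `IdentityForm` ⟹ `OneLoopDrift (stepBal N Lc) (constA … A₁ …) β⁰` (junk extension off the powers as in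
  `ComposedRoad.oneLoopDrift_of_composedLegInterfacePow_identity_avg`; `legAtZero` tables; `windowDecomposition_of_bubble`).
* §2 (SHELL TAILS, kernel level) `tail_sum_le_geom_shell` / `tail_sum_le_exp_shell` / `tail_sum_le_shell`: the shell twins of
  `WindowInterface.tail_sum_le_geom/_exp/_le` — hypothesis `Σ_{‖w‖∞=r+1}|K w| ≤ 80E(r+1)⁻¹q^{r+1}` instead of the pointwise
  `|K w| ≤ E(r+1)⁻⁴q^{r+1}`; SAME conclusions `80E/((M+1)(1−q))`, `80E(1 + L/δ)/(M+1)`, `80E(1 + c/δ)`.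
* §3 (SHELL WINDOW + SPLIT, kernel level) `window_sub_le_of_shellRows` (`Σ_shell|K − K⁰| ≤ D/n` on the `M ≤ n` shells of the window
  ⟹ `|Σ_window K − Σ_window K⁰| ≤ D`), `windowSum_of_split` (+ tail `T` + identification `U` ⟹ `|B − Σ_window K⁰| ≤ T + U + D`).
* COMPANION `D1BFx/ShellWindowLegs` (§4 leg level, one shell; §5 the END `oneLoopDrift_of_shellLegRowsPow_identity_avg` — the
  binder list of `ComposedRoad.oneLoopDrift_of_composedLegInterfacePow_identity_avg` with every leg carrying a SHELL row on the window
  and a SHELL row with the scale-`n` exponential beyond it, the pointwise (W2′) rows and pointwise power tails demanded ONLY of a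
  designated pointwise-good leg of each pair; pointwise rows IMPLY shell rows, so that END is strictly MORE GENERAL than the tree's).
NOT HERE: that any actual leg (the diagonal of `D1BFx.GluonLeg.Ga`, `D1BFx.GhostLeg.Ggh`) satisfies the shell rows (analytic; a later
leaf — beta-num-g33's ENGINE-2 tabulates the averaged currency, evidence-grade only); the leg level (`D1BFx/ShellWindowLegs`); the
scalar-leg END and the C3 twin (`D1BFx/ShellGradedRoad`).  Unit `b2b-balaban-beta-d1-formalise-leaf-07` (gen 4), D1 formalisation swarm; `LEAVES-BFx.md` sub-row C3-SHELL.
-/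

namespace Summit.QuantumFields.BalabanUV.Beta.D1BFx.ShellWindowInterface

open Finset
open scoped BigOperators
open Literature.Probability.LatticeModels (annulus)
open Literature.MathematicalPhysics.QuantumFieldTheory.Balaban1983to89
open Literature.MathematicalPhysics.QuantumFieldTheory.Balaban1983to89.FlowStep (HBeta)
open Literature.MathematicalPhysics.QuantumFieldTheory.Balaban1983to89.Beta
open Literature.MathematicalPhysics.QuantumFieldTheory.Balaban1983to89.Beta.TransverseStructure (E4)
open Literature.MathematicalPhysics.QuantumFieldTheory.Balaban1983to89.Beta.LeadingCoefficient (leadingIntegrand kappaBal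
  transverseValue)
open Literature.MathematicalPhysics.QuantumFieldTheory.Balaban1983to89.Beta.DyadicShell (Pt toReal supNorm mem_annulus_iff
  ne_zero_of_mem_annulus supNorm_eq_of_mem_sphere sum_Ico_shellSum)
open Literature.MathematicalPhysics.QuantumFieldTheory.Balaban1983to89.Beta.WindowLog (shellSum)
open Literature.MathematicalPhysics.QuantumFieldTheory.Balaban1983to89.Beta.TransferUV (card_annulus_succ_four_le)
open Literature.MathematicalPhysics.QuantumFieldTheory.Balaban1983to89.Beta.LargeLWindow (WindowDecomposition)
open Literature.MathematicalPhysics.QuantumFieldTheory.Balaban1983to89.Beta.LargeLWindow.WindowDecomposition (constA)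
open Literature.MathematicalPhysics.QuantumFieldTheory.Balaban1983to89.Beta.BubbleTransfer (Leg lattBubble contBubble bubbleConst
  windowDecomposition_of_bubble abs_moment_le)
open Literature.MathematicalPhysics.QuantumFieldTheory.Balaban1983to89.Beta.Drift (OneLoopDrift)
open Literature.MathematicalPhysics.QuantumFieldTheory.Balaban1983to89.Beta.MarginalTelescoping (composedCoeff IdentityForm)
open Literature.MathematicalPhysics.QuantumFieldTheory.Balaban1983to89.Beta.ComposedRoad (legAtZero legAtZero_f legAtZero_a
  legAtZero_A legAtZero_B powFamily powFamily_pow oneLoopDrift_of_composedWindow_identity abs_convexComb_sub_le)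

noncomputable section

/-! ## §1 The A₁-form of the wall along the powers `n = Lc^m`, identity shape -/

section AOneForm

variable {ι : Type*} {s : Finset ι} {cc₀ : ι → ℝ} {P Q : ι → Leg}

/-- [folklore] **THE WALL IN A₁-FORM ALONG THE POWERS ⟹ DRIFT.**  Leg table `(s, cc₀, P, Q)` of total degree `6` with the Bałaban
continuum moment (`hdeg`, `hval`); window comparability (`hc`, `hM`, `hML`); for every `m ≥ 1` ONE number:
`|composedCoeff μC m − Σ_{0<‖w‖∞≤M(Lc^m)} w_μw_ν·lattBubble(Lc^m, 0; w)| ≤ A₁` (the table legs read at `k = 0`); `IdentityForm μC β⁰`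
⟹ `OneLoopDrift (stepBal N Lc) (constA (|κ|·24 + |κ|·110592) bubbleConst A₁ c (κ·T)) β⁰`.  Everything the wall asks of the actual
integrand is in `A₁`.  (Junk extension off the powers: there `B n :=` the table's own window sum, so `hA₁` holds with `0 ≤ A₁`.) -/
theorem oneLoopDrift_of_windowSumPow_identity {β : HBeta} (S : B12Beta.OneLoopSplit β)
    (hdeg : ∀ i ∈ s, (P i).a + (Q i).a = 6) {μ ν : Fin 4} (hμν : μ ≠ ν) {N : ℝ} (hN : N ≠ 0)
    (hval : ∀ x : E4, x ≠ 0 → x μ * x ν * contBubble s cc₀ P Q x = leadingIntegrand (kappaBal N) μ ν x)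
    {Lc : ℕ} (hL : 2 ≤ Lc) {μC : ℕ → ℕ → ℝ} {A₁ cc : ℝ} {M : ℕ → ℕ}
    (hc : 1 ≤ cc) (hM : ∀ L : ℕ, 2 ≤ L → 1 ≤ M L ∧ (L : ℝ) ≤ cc * M L) (hML : ∀ L : ℕ, 2 ≤ L → M L ≤ L)
    (hA₁ : ∀ m : ℕ, 1 ≤ m → |composedCoeff μC m - ∑ w ∈ annulus 4 0 (M (Lc ^ m)),
        toReal w μ * toReal w ν * lattBubble s cc₀ P Q (Lc ^ m) 0 w| ≤ A₁)
    (hid : IdentityForm μC S.β0) :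
    OneLoopDrift (B12Normalization.stepBal N Lc)
      (constA (|kappaBal N| * 24 + |kappaBal N| * 110592) (bubbleConst s cc₀ P Q) A₁ cc (kappaBal N * transverseValue)) S.β0 := by
  classical
  have hrec : ∀ n : ℕ, (∃ m : ℕ, n = Lc ^ m) → 2 ≤ n → ∃ m : ℕ, 1 ≤ m ∧ n = Lc ^ m := by
    rintro n ⟨m, rfl⟩ hn
    refine ⟨m, ?_, rfl⟩
    rcases Nat.eq_zero_or_pos m with h0 | h0
    · subst h0; simp at hn
    · exact h0
  have hA₁nn : 0 ≤ A₁ := (abs_nonneg _).trans (hA₁ 1 le_rfl)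
  -- the table's own window sum at blocking factor `n` (legs read at `k = 0`)
  let W0 : ℕ → ℝ := fun n => ∑ w ∈ annulus 4 0 (M n), toReal w μ * toReal w ν * lattBubble s cc₀ P Q n 0 w
  let Bx : ℕ → ℝ := fun n => if ∃ m : ℕ, n = Lc ^ m then powFamily μC Lc n else W0 n
  have hlatt : ∀ n k : ℕ, ∀ w : Pt,
      lattBubble s cc₀ (fun i => legAtZero (P i)) (fun i => legAtZero (Q i)) n k w = lattBubble s cc₀ P Q n 0 w :=
    fun _ _ _ => rfl
  have hA₁' : ∀ n : ℕ, 2 ≤ n → ∀ k : ℕ, |Bx n - ∑ w ∈ annulus 4 0 (M n), toReal w μ * toReal w ν *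
      lattBubble s cc₀ (fun i => legAtZero (P i)) (fun i => legAtZero (Q i)) n k w| ≤ A₁ := by
    intro n hn k
    simp_rw [hlatt]
    by_cases hA : ∃ m : ℕ, n = Lc ^ m
    · obtain ⟨m, hm, rfl⟩ := hrec n hA hn
      have hA' : ∃ m' : ℕ, Lc ^ m = Lc ^ m' := ⟨m, rfl⟩
      simp only [Bx, hA', if_true, powFamily_pow hL m]
      exact hA₁ m hm
    · simp only [Bx, W0, hA, if_false, sub_self, abs_zero]
      exact hA₁nn
  have hdeg' : ∀ i ∈ s, (legAtZero (P i)).a + (legAtZero (Q i)).a = 6 := hdeg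
  have hval' : ∀ x : E4, x ≠ 0 →
      x μ * x ν * contBubble s cc₀ (fun i => legAtZero (P i)) (fun i => legAtZero (Q i)) x =
        leadingIntegrand (kappaBal N) μ ν x := hval
  have W := windowDecomposition_of_bubble (β0 := fun n _ => Bx n) (P := fun i => legAtZero (P i))
    (Q := fun i => legAtZero (Q i)) hdeg' hval' hc hM hA₁'
  have hcomp' : ∀ m : ℕ, composedCoeff μC m = Bx (Lc ^ m) := fun m => by
    have hA : ∃ m' : ℕ, Lc ^ m = Lc ^ m' := ⟨m, rfl⟩
    simp only [Bx, hA, if_true, powFamily_pow hL m]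
  exact oneLoopDrift_of_composedWindow_identity S W hN hμν hML hL hid hcomp'

end AOneForm

/-! ## §2 Shell tails (kernel level): the exterior sum from SHELL-ℓ¹ bounds -/

section ShellTail

/-- [folklore] **(W3a) EXTERIOR TAIL FROM SHELL SUMS, geometric form.**  If `Σ_{‖w‖∞=r+1}|K w| ≤ 80E(r+1)⁻¹q^{r+1}` for every
`r ≥ M` (`0 ≤ q < 1`), then `|Σ_{M<‖w‖∞≤R} K w| ≤ 80E/((M+1)(1−q))` for every `R ≥ M`.  (The pointwise hypothesis of
`WindowInterface.tail_sum_le_geom` implies this one by `#shell ≤ 80(r+1)³`; the conclusion is the same.) -/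
theorem tail_sum_le_geom_shell {K : Pt → ℝ} {E q : ℝ} {M R : ℕ} (hE : 0 ≤ E) (hq0 : 0 ≤ q) (hq1 : q < 1) (hMR : M ≤ R)
    (h : ∀ r : ℕ, M ≤ r → ∑ w ∈ annulus 4 r (r + 1), |K w| ≤ 80 * E / ((r : ℝ) + 1) * q ^ (r + 1)) :
    |∑ w ∈ annulus 4 M R, K w| ≤ 80 * E / (((M : ℝ) + 1) * (1 - q)) := by
  have h1q : 0 < 1 - q := by linarith
  have hM1 : (0 : ℝ) < (M : ℝ) + 1 := by positivity
  have hshell : ∀ r ∈ Finset.Ico M R, shellSum (fun w => |K w|) r ≤ 80 * E / ((M : ℝ) + 1) * q ^ (r + 1) := by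
    intro r hr
    have hMr : M ≤ r := (Finset.mem_Ico.mp hr).1
    have hMr' : (M : ℝ) + 1 ≤ (r : ℝ) + 1 := by exact_mod_cast Nat.succ_le_succ hMr
    calc shellSum (fun w => |K w|) r ≤ 80 * E / ((r : ℝ) + 1) * q ^ (r + 1) := h r hMr
      _ ≤ 80 * E / ((M : ℝ) + 1) * q ^ (r + 1) := by
          apply mul_le_mul_of_nonneg_right _ (by positivity)
          exact div_le_div_of_nonneg_left (by positivity) hM1 hMr'
  have hgeom : ∑ r ∈ Finset.Ico M R, q ^ (r + 1) ≤ 1 / (1 - q) := by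
    have e : ∑ r ∈ Finset.Ico M R, q ^ (r + 1) = q * ∑ r ∈ Finset.Ico M R, q ^ r := by
      rw [Finset.mul_sum]
      exact Finset.sum_congr rfl fun r _ => by ring
    rw [e]
    have hg := geom_sum_Ico_le_of_lt_one (m := M) (n := R) hq0 hq1
    have hqM : q * q ^ M ≤ 1 := by
      calc q * q ^ M = q ^ (M + 1) := by ring
        _ ≤ 1 := pow_le_one₀ hq0 hq1.le
    calc q * ∑ r ∈ Finset.Ico M R, q ^ r ≤ q * (q ^ M / (1 - q)) := mul_le_mul_of_nonneg_left hg hq0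
      _ = q * q ^ M / (1 - q) := by ring
      _ ≤ 1 / (1 - q) := div_le_div_of_nonneg_right hqM h1q.le
  calc |∑ w ∈ annulus 4 M R, K w| ≤ ∑ w ∈ annulus 4 M R, |K w| := Finset.abs_sum_le_sum_abs _ _
    _ = ∑ r ∈ Finset.Ico M R, shellSum (fun w => |K w|) r := (sum_Ico_shellSum _ hMR).symm
    _ ≤ ∑ r ∈ Finset.Ico M R, 80 * E / ((M : ℝ) + 1) * q ^ (r + 1) := Finset.sum_le_sum hshell
    _ = 80 * E / ((M : ℝ) + 1) * ∑ r ∈ Finset.Ico M R, q ^ (r + 1) := by rw [Finset.mul_sum]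
    _ ≤ 80 * E / ((M : ℝ) + 1) * (1 / (1 - q)) := mul_le_mul_of_nonneg_left hgeom (by positivity)
    _ = 80 * E / (((M : ℝ) + 1) * (1 - q)) := by field_simp

/-- [folklore] **(W3a) EXTERIOR TAIL FROM SHELL SUMS, exponential form**: `Σ_{‖w‖∞=r+1}|K w| ≤ 80E(r+1)⁻¹e^{−(δ/L)(r+1)}` beyond `M`
(`δ > 0`, `L > 0`) gives `|Σ_{M<‖w‖∞≤R} K w| ≤ 80E(1 + L/δ)/(M+1)`. -/
theorem tail_sum_le_exp_shell {K : Pt → ℝ} {E δ Lr : ℝ} {M R : ℕ} (hE : 0 ≤ E) (hδ : 0 < δ) (hL : 0 < Lr) (hMR : M ≤ R)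
    (h : ∀ r : ℕ, M ≤ r → ∑ w ∈ annulus 4 r (r + 1), |K w| ≤
      80 * E / ((r : ℝ) + 1) * Real.exp (-(δ / Lr) * ((r : ℝ) + 1))) :
    |∑ w ∈ annulus 4 M R, K w| ≤ 80 * E * (1 + Lr / δ) / ((M : ℝ) + 1) := by
  set q : ℝ := Real.exp (-(δ / Lr)) with hq
  have hq0 : 0 ≤ q := (Real.exp_pos _).le
  have hx : 0 < δ / Lr := div_pos hδ hL
  have hq1 : q < 1 := Real.exp_lt_one_iff.mpr (by linarith)
  have h' : ∀ r : ℕ, M ≤ r → ∑ w ∈ annulus 4 r (r + 1), |K w| ≤ 80 * E / ((r : ℝ) + 1) * q ^ (r + 1) := by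
    intro r hr
    have e : Real.exp (-(δ / Lr) * ((r : ℝ) + 1)) = q ^ (r + 1) := by
      rw [hq, ← Real.exp_nat_mul]
      congr 1
      push_cast
      ring
    rw [← e]
    exact h r hr
  have hM1 : (0 : ℝ) < (M : ℝ) + 1 := by positivity
  have h1q : 0 < 1 - q := by linarith
  have hrec : 1 / (1 - q) ≤ 1 + Lr / δ := by
    have h1 : q ≤ 1 / (1 + δ / Lr) := by
      rw [hq, Real.exp_neg, one_div]
      exact inv_anti₀ (by positivity) (by linarith [Real.add_one_le_exp (δ / Lr)])
    have h2 : (δ / Lr) / (1 + δ / Lr) ≤ 1 - q := by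
      have : (δ / Lr) / (1 + δ / Lr) = 1 - 1 / (1 + δ / Lr) := by field_simp; ring
      linarith
    have h3 : 0 < (δ / Lr) / (1 + δ / Lr) := by positivity
    calc 1 / (1 - q) ≤ 1 / ((δ / Lr) / (1 + δ / Lr)) := one_div_le_one_div_of_le h3 h2
      _ = 1 + Lr / δ := by field_simp; ring
  calc |∑ w ∈ annulus 4 M R, K w| ≤ 80 * E / (((M : ℝ) + 1) * (1 - q)) := tail_sum_le_geom_shell hE hq0 hq1 hMR h'
    _ = 80 * E / ((M : ℝ) + 1) * (1 / (1 - q)) := by field_simp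
    _ ≤ 80 * E / ((M : ℝ) + 1) * (1 + Lr / δ) := mul_le_mul_of_nonneg_left hrec (by positivity)
    _ = 80 * E * (1 + Lr / δ) / ((M : ℝ) + 1) := by ring

/-- [folklore] **(W3a) EXTERIOR TAIL FROM SHELL SUMS under window comparability** (`1 ≤ M`, `L ≤ c·M`): `80E(1 + c/δ)`, free of
`L`, `M`, `R`. -/
theorem tail_sum_le_shell {K : Pt → ℝ} {E δ cc : ℝ} {L M R : ℕ} (hE : 0 ≤ E) (hδ : 0 < δ) (hL : 1 ≤ L) (hM : 1 ≤ M)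
    (hLM : (L : ℝ) ≤ cc * M) (hMR : M ≤ R)
    (h : ∀ r : ℕ, M ≤ r → ∑ w ∈ annulus 4 r (r + 1), |K w| ≤
      80 * E / ((r : ℝ) + 1) * Real.exp (-(δ / L) * ((r : ℝ) + 1))) :
    |∑ w ∈ annulus 4 M R, K w| ≤ 80 * E * (1 + cc / δ) := by
  have hM0 : (1 : ℝ) ≤ M := by exact_mod_cast hM
  have hLpos : (0 : ℝ) < L := by exact_mod_cast (by omega : 0 < L)
  have hcc : 0 ≤ cc := by nlinarith
  have h1 := tail_sum_le_exp_shell (Lr := (L : ℝ)) hE hδ hLpos hMR h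
  have hM1 : (0 : ℝ) < (M : ℝ) + 1 := by positivity
  have hcδ : 0 ≤ cc / δ := div_nonneg hcc hδ.le
  have h80 : 0 ≤ 80 * E := by positivity
  calc |∑ w ∈ annulus 4 M R, K w| ≤ 80 * E * (1 + (L : ℝ) / δ) / ((M : ℝ) + 1) := h1
    _ ≤ 80 * E * (1 + cc / δ * M) / ((M : ℝ) + 1) := by
        apply div_le_div_of_nonneg_right _ hM1.le
        apply mul_le_mul_of_nonneg_left _ h80
        have h2 : (L : ℝ) / δ ≤ cc / δ * M := by
          rw [div_mul_eq_mul_div]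
          exact div_le_div_of_nonneg_right hLM hδ.le
        linarith
    _ ≤ 80 * E * (1 + cc / δ) := by
        rw [div_le_iff₀ hM1]
        nlinarith

end ShellTail

/-! ## §3 Shell window and the split (kernel level) -/

section ShellWindow

/-- [folklore] **THE IN-WINDOW COMPARISON FROM SHELL SUMS.**  If on every shell `‖w‖∞ = r+1 ≤ M` of the window
`Σ_{‖w‖∞=r+1}|K w − K⁰ w| ≤ D/n` and `M ≤ n`, then `|Σ_{0<‖w‖∞≤M} K − Σ_{0<‖w‖∞≤M} K⁰| ≤ D` (at most `M ≤ n` shells). -/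
theorem window_sub_le_of_shellRows {K K0 : Pt → ℝ} {D : ℝ} {n M : ℕ} (hD : 0 ≤ D) (hn : 1 ≤ n) (hMn : M ≤ n)
    (h : ∀ r : ℕ, r + 1 ≤ M → ∑ w ∈ annulus 4 r (r + 1), |K w - K0 w| ≤ D / n) :
    |∑ w ∈ annulus 4 0 M, K w - ∑ w ∈ annulus 4 0 M, K0 w| ≤ D := by
  have hn0 : (0 : ℝ) < n := by exact_mod_cast hn
  rw [← Finset.sum_sub_distrib]
  calc |∑ w ∈ annulus 4 0 M, (K w - K0 w)| ≤ ∑ w ∈ annulus 4 0 M, |K w - K0 w| := Finset.abs_sum_le_sum_abs _ _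
    _ = ∑ r ∈ Finset.Ico 0 M, shellSum (fun w => |K w - K0 w|) r := (sum_Ico_shellSum _ (Nat.zero_le M)).symm
    _ ≤ ∑ r ∈ Finset.Ico 0 M, D / n := by
        refine Finset.sum_le_sum fun r hr => ?_
        have hr' : r + 1 ≤ M := by
          have := (Finset.mem_Ico.mp hr).2
          omega
        exact h r hr'
    _ = (M : ℝ) * (D / n) := by rw [Finset.sum_const, Nat.card_Ico, Nat.sub_zero, nsmul_eq_mul]
    _ ≤ (n : ℝ) * (D / n) := mul_le_mul_of_nonneg_right (by exact_mod_cast hMn) (by positivity)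
    _ = D := by field_simp

/-- [folklore] **THE SPLIT AT ONE BLOCKING FACTOR.**  In-window comparison `|Σ_window K − Σ_window K⁰| ≤ D`, a uniform bound `T` on
the exterior sums `Σ_{M<‖w‖∞≤R} K` (`R ≥ M`) and the identification `|B − Σ_{0<‖w‖∞≤R₀} K| ≤ U` for SOME `R₀ ≥ M` give the
A₁-form `|B − Σ_window K⁰| ≤ T + U + D`.  (The one-point content of `WindowInterface.hout_of_split` + `LargeLWindow.Split.rem_of_split`.) -/
theorem windowSum_of_split {B : ℝ} {K K0 : Pt → ℝ} {D T U : ℝ} {M : ℕ}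
    (hin : |∑ w ∈ annulus 4 0 M, K w - ∑ w ∈ annulus 4 0 M, K0 w| ≤ D)
    (htail : ∀ R : ℕ, M ≤ R → |∑ w ∈ annulus 4 M R, K w| ≤ T)
    (hident : ∃ R₀ : ℕ, M ≤ R₀ ∧ |B - ∑ w ∈ annulus 4 0 R₀, K w| ≤ U) :
    |B - ∑ w ∈ annulus 4 0 M, K0 w| ≤ T + U + D := by
  obtain ⟨R₀, hMR, hU⟩ := hident
  have hT := htail R₀ hMR
  have e : ∑ w ∈ annulus 4 0 R₀, K w = ∑ w ∈ annulus 4 0 M, K w + ∑ w ∈ annulus 4 M R₀, K w := by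
    rw [← sum_Ico_shellSum _ (Nat.zero_le R₀), ← sum_Ico_shellSum _ (Nat.zero_le M), ← sum_Ico_shellSum _ hMR,
      Finset.sum_Ico_consecutive _ (Nat.zero_le M) hMR]
  rw [e] at hU
  calc |B - ∑ w ∈ annulus 4 0 M, K0 w|
      = |(B - (∑ w ∈ annulus 4 0 M, K w + ∑ w ∈ annulus 4 M R₀, K w)) + ∑ w ∈ annulus 4 M R₀, K w
          + (∑ w ∈ annulus 4 0 M, K w - ∑ w ∈ annulus 4 0 M, K0 w)| := by ring_nf
    _ ≤ |(B - (∑ w ∈ annulus 4 0 M, K w + ∑ w ∈ annulus 4 M R₀, K w)) + ∑ w ∈ annulus 4 M R₀, K w|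
          + |∑ w ∈ annulus 4 0 M, K w - ∑ w ∈ annulus 4 0 M, K0 w| := abs_add_le _ _
    _ ≤ (|B - (∑ w ∈ annulus 4 0 M, K w + ∑ w ∈ annulus 4 M R₀, K w)| + |∑ w ∈ annulus 4 M R₀, K w|) + D :=
        add_le_add (abs_add_le _ _) hin
    _ ≤ (U + T) + D := by gcongr
    _ = T + U + D := by ring

end ShellWindow

end

end Summit.QuantumFields.BalabanUV.Beta.D1BFx.ShellWindowInterface
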